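/-
Copyright (c) 2026. All rights reserved.
Released under Apache 2.0 license as described in the file LICENSE.
-/
import Literature.NumberTheory.GelbartRogawski1991.UnitaryDualPairSplittingDatum
import HarnessLib

-- buildfix G11b-3 recipe (LEDGER B13-1/B13-3): elaborate sequentially so the trailing `attribute [implicit_reducible]`
-- block (reducibilityCoreExt is keyed to the async environment branch) is in force at `.olean` export.
set_option Elab.async false

/-!
# The Gram matrix of `Res(V ⊗ W)` for DIAGONAL hermitian forms is diagonal

[folklore] bookkeeping for the unitary dual pair `U(V) × U(W) ⊂ Sp(𝕎)`, `𝕎 = Res_{E/F}(V ⊗_E W)`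
([GelbartRogawski1991] §3.1 p. 454): when `T_V = diag(a)` and `T_W = diag(b)` the Gram matrix
`𝕋_F = reindex e e (T_V ⊗ₖ T_W)` of `UnitaryDualPair.gram` is `diag(k ↦ a (e⁻¹ k)₁ · b (e⁻¹ k)₂)`, and so is its
adelic image `UnitaryDualPair.adelicGram` (`= 𝕋_F ⊗ 1`).  This is the hypothesis shape `T = diagonal t₀` under which
the archimedean Schrödinger–Folland dictionary (`Literature.NumberTheory.Weil1964.ArchFollandTorus`) is stated, so the
lemmas below are the `exact` discharging it at the CM pin (`realDiagonal`, all `T_V`, `T_W` diagonal).  Also recorded: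
the Gram matrices are units of `M_n` (not only their determinants), the form in which Weil's majorant theorem
`hasThetaMajorants_omega_comp (hT : IsUnit T)` consumes them.

No records, no `sorry`; every statement is definitional bookkeeping ([folklore]).
-/

noncomputable section

open scoped Matrix Kronecker
open NumberField

namespace Literature.NumberTheory.GelbartRogawski1991.UnitaryDualPair

variable (F : Type) [Field F] [NumberField F] {N M n : ℕ} (e : Fin N × Fin M ≃ Fin n)

omit [NumberField F] in
/-- `reindex e e (diag a ⊗ₖ diag b) = diag (k ↦ a (e⁻¹ k)₁ * b (e⁻¹ k)₂)`. [folklore] -/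
theorem gram_diagonal (a : Fin N → F) (b : Fin M → F) :
    gram F e (Matrix.diagonal a) (Matrix.diagonal b) =
      Matrix.diagonal fun k => a (e.symm k).1 * b (e.symm k).2 := by
  rw [gram, Matrix.diagonal_kronecker_diagonal, Matrix.reindex_apply, Matrix.submatrix_diagonal_equiv]
  rfl

/-- `𝕋 = diag (k ↦ a (e⁻¹ k)₁ * b (e⁻¹ k)₂) ⊗ 1 ∈ M_n(𝔸_F)` for diagonal `T_V = diag a`, `T_W = diag b`. [folklore] -/
theorem adelicGram_diagonal (a : Fin N → F) (b : Fin M → F) :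
    adelicGram F e (Matrix.diagonal a) (Matrix.diagonal b) =
      (Matrix.diagonal fun k => a (e.symm k).1 * b (e.symm k).2).map (algebraMap F (AdeleRing (𝓞 F) F)) := by
  rw [adelicGram_eq_map, gram_diagonal]

/-- The same, with the `algebraMap` pushed inside the diagonal. [folklore] -/
theorem adelicGram_diagonal' (a : Fin N → F) (b : Fin M → F) :
    adelicGram F e (Matrix.diagonal a) (Matrix.diagonal b) =
      Matrix.diagonal fun k => algebraMap F (AdeleRing (𝓞 F) F) (a (e.symm k).1 * b (e.symm k).2) := by
  rw [adelicGram_diagonal, Matrix.diagonal_map (map_zero _)]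

variable {TV : Matrix (Fin N) (Fin N) F} {TW : Matrix (Fin M) (Fin M) F}

omit [NumberField F] in
/-- `𝕋_F ∈ GL_n(F)` (as a matrix unit) when `det T_V`, `det T_W` are units. [folklore] -/
theorem isUnit_gram (hVd : IsUnit TV.det) (hWd : IsUnit TW.det) : IsUnit (gram F e TV TW) :=
  (Matrix.isUnit_iff_isUnit_det _).mpr (isUnit_det_gram F e hVd hWd)

/-- `𝕋 ∈ GL_n(𝔸_F)` (as a matrix unit) when `det T_V`, `det T_W` are units — the hypothesis `hT : IsUnit T` of
`Literature.NumberTheory.Weil1964.hasThetaMajorants_omega_comp`. [folklore] -/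
theorem isUnit_adelicGram (hVd : IsUnit TV.det) (hWd : IsUnit TW.det) : IsUnit (adelicGram F e TV TW) :=
  (Matrix.isUnit_iff_isUnit_det _).mpr (isUnit_det_adelicGram F e hVd hWd)

omit [NumberField F] in
/-- Diagonal Gram data: `det (diag a)` is a unit iff no `aᵢ` vanishes (over a field: all `aᵢ ≠ 0`). [folklore] -/
theorem isUnit_det_diagonal_of_ne_zero {a : Fin N → F} (ha : ∀ i, a i ≠ 0) :
    IsUnit (Matrix.diagonal a).det := by
  rw [Matrix.det_diagonal]
  exact IsUnit.mk0 _ (Finset.prod_ne_zero_iff.mpr fun i _ => ha i)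

/-! ### Build-lane note (ops-buildfix G11b-3 recipe, LEDGER B13-1, 2026-08-21)
`lean -o` (the hub build lane, never `lean`/the gate check) runs Lean 4.32's library-suggestion indexers
(`Lean.LibrarySuggestions.SymbolFrequency` / `SineQuaNon`, from their `exportEntriesFn`) over the statement of
every local theorem that is not a denied premise; on this family's statements (very large dependent binder
telescopes through the theta-kernel / dual-pair data) that fold runs for tens of minutes to hours and the build
lane kills the job (incident G11b-3, run/shared/lean/ops/buildfix/G11b-3-DOSSIER.md). `isDeniedPremise` skips
`[implicit_reducible]` constants before any fold, and a reducibility status on a *theorem* is inert (Meta never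
unfolds `thmInfo`; the kernel ignores the attribute), so the public theorems of this file are tagged
`[implicit_reducible]` purely to keep them out of that index. Only other effect: they are not offered by
`+suggestions` premise selectors. No statement or proof is changed; superseded if the operator lands a
deny-list form (`HarnessLib.PremiseIndex`). -/
set_option allowUnsafeReducibility true in
attribute [implicit_reducible]
  gram_diagonal adelicGram_diagonal adelicGram_diagonal' isUnit_gram isUnit_adelicGram
  isUnit_det_diagonal_of_ne_zero

end Literature.NumberTheory.GelbartRogawski1991.UnitaryDualPair

end
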